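import Literature.Barriers.Parity.SiegelZeroDichotomyPairHLMainTermReduction
import Literature.Barriers.Parity.SiegelZeroDichotomyPairHLSieveEuler
import HarnessLib

/-!
# Tao–Teräväinen 2022, §8 (`k = 2`): the six-slot box and its Euler product structure

Topic `Literature/Barriers/Parity`, sub-namespace `TaoTeravainen`; combinatorial preliminaries for
the Euler product of §8 of T. Tao, J. Teräväinen, *The Hardy–Littlewood–Chowla conjecture in the
presence of a Siegel zero*, J. London Math. Soc. (2) 106 (2022), arXiv:2109.06291: "Inserting this back
into the left-hand side of (8.8) and factoring the Euler product using (2.11), we can thus write that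
left-hand side as `log^k x ∫_{ℝ^{3k}} ∏_p E_{p,t} ∏_j F_j(t_{0,j}) f(t_{1,j}) f(t_{2,j}) dt`, where
`E_{p,t} := ∑_{d₁,…,d_k ∈ ℕ_(p)} ∏_{i<j} 1_{(d_i,d_j)∣h_i−h_j}/[d₁,…,d_k] ∏_j c_{d_j,t}`" — the
identity (2.11) being the Euler product over "multiplicative" sums in several variables. Everything
here is PROVED and elementary. At `k = 2` there are six slots `(j, i)`, `j ∈ Fin 2` (the shift),
`i ∈ Fin 3` (`i = 0`: the variable `d₀` of `χ(d₀)Φ((y+h_j)/d₀)`, any exponent `≤ A`; `i = 1, 2`: the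
squarefree sieve variables). We sum over the finite box of six-tuples composed of a fixed finite set of
primes `P`:

* `locRange`, `locBox`, `expBox`, `decodeBox` (`α ↦ (∏_{p∈P} p^{α_p(k)})_k`), `sixBox P A`
  (its image), `factorization_decodeBox`, `decodeBox_injOn`, `mem_sixBox_of` (membership from
  valuations), `sum_sixBox_eq_sum_expBox`, and **`sum_sixBox_eq_prod`** — a summand that factors over
  the primes sums to the product of the local sums (`Finset.prod_univ_sum`);
* the factorizations of the ingredients at `decodeBox α`: `moebius_decodeBox`, `cast_decodeBox`
  (for characters), `log_decodeBox`, `factorization_slotLcm`, and `crtDensity_decodeBox`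
  (via `crtDensity_eq_prod_primes`). [cite: TaoTeravainen2021, §2 (2.11) and §8 (8.17)–(8.18)]
-/

noncomputable section

open Finset Real
open scoped ArithmeticFunction.Moebius

namespace Literature.Barriers.Parity

namespace TaoTeravainen

/-- The six slots: `(j, i)` with `j` the shift and `i = 0` the `d`-variable, `i = 1, 2` the sieve
variables. [cite: TaoTeravainen2021, §8 (8.9)] -/
abbrev Slot : Type := Fin 2 × Fin 3

/-- The allowed local exponents: `≤ A` in the `d`-slots, `≤ 1` in the sieve slots. [cite: TaoTeravainen2021, §8] -/
def locRange (A : ℕ) (k : Slot) : Finset ℕ := if k.2 = 0 then range (A + 1) else range 2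

/-- The local box of exponent patterns at one prime. [cite: TaoTeravainen2021, §8 (8.18)] -/
def locBox (A : ℕ) : Finset (Slot → ℕ) := Fintype.piFinset (locRange A)

/-- The global box of exponent functions. [folklore] -/
def expBox (P : Finset ℕ) (A : ℕ) : Finset (P → Slot → ℕ) := Fintype.piFinset fun _ => locBox A

/-- Decoding exponents to six-tuples: `(decodeBox α) k = ∏_{p ∈ P} p^{α_p(k)}`. [folklore] -/
def decodeBox (P : Finset ℕ) (α : P → Slot → ℕ) : Slot → ℕ := fun k => ∏ p : P, (p : ℕ) ^ α p k

/-- **The six-slot box**: six-tuples composed of the primes in `P`, with exponents `≤ A` in the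
`d`-slots and squarefree in the sieve slots. [cite: TaoTeravainen2021, §8] -/
def sixBox (P : Finset ℕ) (A : ℕ) : Finset (Slot → ℕ) := (expBox P A).image (decodeBox P)

variable {P : Finset ℕ} (hP : ∀ p ∈ P, p.Prime)
include hP

/-- Coordinates of decoded tuples are positive. [folklore] -/
theorem decodeBox_pos (α : P → Slot → ℕ) (k : Slot) : 0 < decodeBox P α k :=
  prod_pos fun p _ => pow_pos (hP p p.2).pos _

/-- **Valuations of decoded tuples**: `v_p((decodeBox α) k) = α_p(k)` for `p ∈ P`. [folklore] -/
theorem factorization_decodeBox (α : P → Slot → ℕ) (k : Slot) (p : P) :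
    (decodeBox P α k).factorization p = α p k := by
  classical
  unfold decodeBox
  rw [Nat.factorization_prod fun (q : P) _ => (pow_pos (hP q q.2).pos _).ne']
  rw [Finset.sum_apply']
  rw [Finset.sum_eq_single p]
  · rw [(hP p p.2).factorization_pow, Finsupp.single_eq_same]
  · intro q _ hqp
    rw [(hP q q.2).factorization_pow, Finsupp.single_eq_of_ne]
    exact fun h => hqp (Subtype.ext h.symm)
  · intro h; exact absurd (mem_univ p) h

/-- Valuations at primes outside `P` vanish. [folklore] -/
theorem factorization_decodeBox_of_notMem (α : P → Slot → ℕ) (k : Slot) {p : ℕ} (hp : p ∉ P) :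
    (decodeBox P α k).factorization p = 0 := by
  classical
  unfold decodeBox
  rw [Nat.factorization_prod fun (q : P) _ => (pow_pos (hP q q.2).pos _).ne', Finset.sum_apply']
  refine sum_eq_zero fun q _ => ?_
  rw [(hP q q.2).factorization_pow, Finsupp.single_eq_of_ne]
  intro h; exact hp (h ▸ q.2)

/-- The prime factors of decoded tuples lie in `P`. [folklore] -/
theorem primeFactors_decodeBox_subset (α : P → Slot → ℕ) (k : Slot) : (decodeBox P α k).primeFactors ⊆ P := by
  intro p hp
  by_contra h
  have := factorization_decodeBox_of_notMem hP α k h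
  rw [Nat.factorization_eq_zero_iff] at this
  rcases this with h1 | h1 | h1
  · exact h1 (Nat.prime_of_mem_primeFactors hp)
  · exact h1 (Nat.dvd_of_mem_primeFactors hp)
  · exact (decodeBox_pos hP α k).ne' h1

/-- `decodeBox` is injective. [folklore] -/
theorem decodeBox_injective : Function.Injective (decodeBox P) := by
  intro α β h
  funext p k
  have := congr_arg (fun n : Slot → ℕ => (n k).factorization p) h
  simpa only [factorization_decodeBox hP] using this

/-- `decodeBox` is injective on any set. [folklore] -/
theorem decodeBox_injOn (s : Set (P → Slot → ℕ)) : Set.InjOn (decodeBox P) s :=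
  (decodeBox_injective hP).injOn

/-- **Membership in the box from valuations**: a six-tuple of positive integers composed of primes
of `P`, with `v_p ≤ A` in the `d`-slots and `v_p ≤ 1` in the sieve slots, lies in `sixBox P A`. [folklore] -/
theorem mem_sixBox_of {A : ℕ} {n : Slot → ℕ} (hn0 : ∀ k, n k ≠ 0) (hnP : ∀ k, (n k).primeFactors ⊆ P)
    (hA : ∀ k, ∀ p ∈ P, (n k).factorization p ∈ locRange A k) : n ∈ sixBox P A := by
  classical
  unfold sixBox
  rw [mem_image]
  refine ⟨fun p k => (n k).factorization p, ?_, ?_⟩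
  · unfold expBox locBox
    rw [Fintype.mem_piFinset]
    intro p
    rw [Fintype.mem_piFinset]
    intro k
    exact hA k p p.2
  · funext k
    refine Nat.eq_of_factorization_eq (decodeBox_pos hP _ k).ne' (hn0 k) fun p => ?_
    by_cases hp : p ∈ P
    · exact factorization_decodeBox hP _ k ⟨p, hp⟩
    · rw [factorization_decodeBox_of_notMem hP _ k hp]
      symm
      rw [Nat.factorization_eq_zero_iff]
      by_contra h
      rw [not_or, not_or] at h
      push Not at h
      exact hp (hnP k (Nat.mem_primeFactors.mpr ⟨h.1, h.2.1, hn0 k⟩))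

omit hP in
/-- Members of the box: positive, composed of `P`, local exponents in `locRange`. [folklore] -/
theorem mem_sixBox_iff {A : ℕ} {n : Slot → ℕ} :
    n ∈ sixBox P A ↔ ∃ α ∈ expBox P A, decodeBox P α = n := by
  unfold sixBox; rw [mem_image]

omit hP in
/-- Exponent bounds inside `expBox`. [folklore] -/
theorem mem_expBox_iff {A : ℕ} {α : P → Slot → ℕ} :
    α ∈ expBox P A ↔ ∀ p k, α p k ∈ locRange A k := by
  unfold expBox locBox
  rw [Fintype.mem_piFinset]
  simp only [Fintype.mem_piFinset]

omit hP in
/-- The local ranges, unfolded. [folklore] -/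
theorem mem_locRange_iff {A : ℕ} {k : Slot} {a : ℕ} :
    a ∈ locRange A k ↔ (k.2 = 0 ∧ a ≤ A) ∨ (k.2 ≠ 0 ∧ a ≤ 1) := by
  unfold locRange
  split_ifs with h
  · rw [mem_range]; constructor
    · intro ha; exact Or.inl ⟨h, by omega⟩
    · rintro (⟨-, ha⟩ | ⟨h', -⟩) <;> [omega; exact absurd h h']
  · rw [mem_range]; constructor
    · intro ha; exact Or.inr ⟨h, by omega⟩
    · rintro (⟨h', -⟩ | ⟨-, ha⟩) <;> [exact absurd h' h; omega]

/-- **Sum over the box = sum over exponent functions.** [folklore] -/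
theorem sum_sixBox_eq_sum_expBox {M : Type*} [AddCommMonoid M] (A : ℕ) (F : (Slot → ℕ) → M) :
    ∑ n ∈ sixBox P A, F n = ∑ α ∈ expBox P A, F (decodeBox P α) := by
  unfold sixBox
  rw [sum_image fun α _ β _ h => decodeBox_injective hP h]

/-- **The Euler product identity for the box** ((2.11) in six variables): if the summand factors
over the primes at decoded tuples, `F(decodeBox α) = ∏_{p ∈ P} f_p(α_p)` for `α ∈ expBox`, then
`∑_{n ∈ sixBox} F(n) = ∏_{p ∈ P} ∑_{λ ∈ locBox} f_p(λ)`. [cite: TaoTeravainen2021, §2 (2.11); §8 (8.17)] -/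
theorem sum_sixBox_eq_prod {R : Type*} [CommSemiring R] (A : ℕ) (F : (Slot → ℕ) → R)
    (f : P → (Slot → ℕ) → R) (hF : ∀ α ∈ expBox P A, F (decodeBox P α) = ∏ p : P, f p (α p)) :
    ∑ n ∈ sixBox P A, F n = ∏ p : P, ∑ lam ∈ locBox A, f p lam := by
  rw [sum_sixBox_eq_sum_expBox hP, prod_univ_sum]
  unfold expBox
  exact sum_congr rfl hF

/-! ### The factorizations of the ingredients at decoded tuples -/

/-- The prime powers `p^{α_p(k)}`, `p ∈ P`, are pairwise coprime. [folklore] -/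
theorem pairwise_coprime_pow (α : P → Slot → ℕ) (k : Slot) :
    ((Finset.univ : Finset P) : Set P).Pairwise (Function.onFun Nat.Coprime fun p : P => (p : ℕ) ^ α p k) := by
  intro p _ q _ hpq
  refine Nat.Coprime.pow _ _ ((Nat.coprime_primes (hP p p.2) (hP q q.2)).mpr ?_)
  exact fun h => hpq (Subtype.ext h)

/-- **`μ` at decoded tuples**: `μ(∏ p^{α_p}) = ∏ μ(p^{α_p})`, and `μ(p^a) = 1, -1, 0` for
`a = 0, 1, ≥ 2`. [folklore] -/
theorem moebius_decodeBox (α : P → Slot → ℕ) (k : Slot) :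
    (μ (decodeBox P α k) : ℤ) = ∏ p : P, (μ ((p : ℕ) ^ α p k) : ℤ) := by
  unfold decodeBox
  exact ArithmeticFunction.isMultiplicative_moebius.map_prod (fun p : P => (p : ℕ) ^ α p k)
    Finset.univ (pairwise_coprime_pow hP α k)

omit hP in
/-- `μ(p^a)` for a prime `p`. [folklore] -/
theorem moebius_prime_pow {p : ℕ} (hp : p.Prime) (a : ℕ) :
    (μ (p ^ a) : ℤ) = if a = 0 then 1 else if a = 1 then -1 else 0 := by
  rcases Nat.eq_zero_or_pos a with rfl | ha
  · simp
  · rw [ArithmeticFunction.moebius_apply_prime_pow hp ha.ne', if_neg ha.ne']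

omit hP in
/-- **Characters at decoded tuples** (any monoid hom out of `ℕ`-casts): `(∏ p^{α_p} : ZMod q) = ∏ (p : ZMod q)^{α_p}`.
[folklore] -/
theorem cast_decodeBox (q : ℕ) (α : P → Slot → ℕ) (k : Slot) :
    ((decodeBox P α k : ℕ) : ZMod q) = ∏ p : P, ((p : ℕ) : ZMod q) ^ α p k := by
  unfold decodeBox
  push_cast
  rfl

/-- **`log` at decoded tuples**: `log(∏ p^{α_p}) = ∑ α_p log p`. [folklore] -/
theorem log_decodeBox (α : P → Slot → ℕ) (k : Slot) :
    Real.log (decodeBox P α k) = ∑ p : P, (α p k : ℝ) * Real.log (p : ℕ) := by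
  unfold decodeBox
  push_cast
  rw [Real.log_prod fun p _ => (pow_pos (by exact_mod_cast (hP p p.2).pos) _).ne']
  refine sum_congr rfl fun p _ => ?_
  rw [Real.log_pow]

/-- The combined modulus of side `j`: `[n(j,0), [n(j,1), n(j,2)]]`. [cite: TaoTeravainen2021, §8] -/
def slotLcm (n : Slot → ℕ) (j : Fin 2) : ℕ := Nat.lcm (n (j, 0)) (Nat.lcm (n (j, 1)) (n (j, 2)))

omit hP in
/-- `slotLcm` of the tuple `(t.1, t.2.1, t.2.2)` is `tripleLcm t`. [folklore] -/
theorem slotLcm_eq_tripleLcm (n : Slot → ℕ) (j : Fin 2) :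
    slotLcm n j = tripleLcm (n (j, 0), n (j, 1), n (j, 2)) := rfl

omit hP in
/-- **Valuations of the combined modulus**: `v_p [a,[b,c]] = max(v_p a, v_p b, v_p c)` (nonzero entries). [folklore] -/
theorem factorization_slotLcm {n : Slot → ℕ} (hn : ∀ k, n k ≠ 0) (j : Fin 2) (p : ℕ) :
    (slotLcm n j).factorization p =
      max ((n (j, 0)).factorization p) (max ((n (j, 1)).factorization p) ((n (j, 2)).factorization p)) := by
  unfold slotLcm
  rw [Nat.factorization_lcm (hn _) (Nat.lcm_ne_zero (hn _) (hn _)), Finsupp.sup_apply,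
    Nat.factorization_lcm (hn _) (hn _), Finsupp.sup_apply]

omit hP in
/-- `slotLcm ≠ 0` for nonzero entries. [folklore] -/
theorem slotLcm_ne_zero {n : Slot → ℕ} (hn : ∀ k, n k ≠ 0) (j : Fin 2) : slotLcm n j ≠ 0 :=
  Nat.lcm_ne_zero (hn _) (Nat.lcm_ne_zero (hn _) (hn _))

omit hP in
/-- Prime factors of `slotLcm` are among those of the entries. [folklore] -/
theorem primeFactors_slotLcm_subset {n : Slot → ℕ} (hn : ∀ k, n k ≠ 0) (j : Fin 2) {S : Finset ℕ}
    (hS : ∀ k, (n k).primeFactors ⊆ S) : (slotLcm n j).primeFactors ⊆ S := by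
  intro p hp
  have hpP := Nat.prime_of_mem_primeFactors hp
  have hdvd := Nat.dvd_of_mem_primeFactors hp
  have hfac : 0 < (slotLcm n j).factorization p :=
    Nat.Prime.factorization_pos_of_dvd hpP (slotLcm_ne_zero hn j) hdvd
  rw [factorization_slotLcm hn] at hfac
  -- one of the three valuations is positive
  have key : ∀ k, 0 < (n k).factorization p → p ∈ S := fun k hk =>
    hS k (Nat.mem_primeFactors.mpr ⟨hpP, (Nat.Prime.dvd_iff_one_le_factorization hpP (hn k)).mpr hk, hn k⟩)
  rcases lt_max_iff.mp hfac with h | h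
  · exact key _ h
  · rcases lt_max_iff.mp h with h | h
    · exact key _ h
    · exact key _ h

/-- The local CRT density at `p` for the exponent pattern `λ` (`v_j = max_i λ(j,i)`):
`1_{min(v₀,v₁) ≤ v_p(h₁-h₂)} p^{-max(v₀,v₁)}`. [cite: TaoTeravainen2021, §8 (8.18) (the factor
`∏ 1_{(d_i,d_j)∣h_i−h_j}/[d₁,…,d_k]` localised at `p`)] -/
def localDens (p vH : ℕ) (lam : Slot → ℕ) : ℝ :=
  let v : Fin 2 → ℕ := fun j => max (lam (j, 0)) (max (lam (j, 1)) (lam (j, 2)))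
  if min (v 0) (v 1) ≤ vH then ((p : ℝ) ^ max (v 0) (v 1))⁻¹ else 0

omit hP in
/-- `localDens ≥ 0`. [folklore] -/
theorem localDens_nonneg (p vH : ℕ) (lam : Slot → ℕ) : 0 ≤ localDens p vH lam := by
  unfold localDens
  simp only
  split_ifs <;> positivity

/-- **The CRT density at decoded tuples is the product of the local densities** over `P`
(`h₁ ≠ h₂`). [cite: TaoTeravainen2021, §8 (8.17)–(8.18); Lemma 3.3] -/
theorem crtDensity_decodeBox {h₁ h₂ : ℕ} (hne : h₁ ≠ h₂) (α : P → Slot → ℕ) :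
    crtDensity h₁ h₂ (slotLcm (decodeBox P α) 0) (slotLcm (decodeBox P α) 1) =
      ∏ p : P, localDens p ((shiftDiff h₁ h₂).factorization p) (α p) := by
  have hn0 : ∀ k, decodeBox P α k ≠ 0 := fun k => (decodeBox_pos hP α k).ne'
  have hS : ∀ j, (slotLcm (decodeBox P α) j).primeFactors ⊆ P := fun j =>
    primeFactors_slotLcm_subset hn0 j fun k => primeFactors_decodeBox_subset hP α k
  rw [crtDensity_eq_prod_primes hne (slotLcm_ne_zero hn0 0) (slotLcm_ne_zero hn0 1) (hS 0) (hS 1),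
    ← prod_coe_sort P]
  refine prod_congr rfl fun p _ => ?_
  rw [factorization_slotLcm hn0, factorization_slotLcm hn0, factorization_decodeBox hP,
    factorization_decodeBox hP, factorization_decodeBox hP, factorization_decodeBox hP,
    factorization_decodeBox hP, factorization_decodeBox hP]
  rfl

end TaoTeravainen

end Literature.Barriers.Parity
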